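import Mathlib
import HarnessLib
import Literature.Analysis.FluidPDE.KNSSSwirlSupNonpos
import Summits.NavierStokesRegularity.NavierStokesRegularity.Theorems.HalfSpaceWindowDoorCirculationCarryingRigiditySourcedSwirlSourceEstimate

/-!
# Route `HalfSpaceWindowDoor`, crux `CirculationCarryingRigidity` (stmt-NavierStokesRegularity-25311) — the SOURCED SWIRL
# LIOUVILLE TOOL, part 5: the Liouville theorem `f ≤ 0` (`IsSourcedSwirl.nonpos`), `f ≡ 0` for non-negative scalars

KNSS 2009 Thm 5.3 (tree `Literature.Analysis.FluidPDE.KNSS2009_swirl_sup_nonpos_of_lemma21`, with the PROVED Lemma 2.1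
`KNSS2009_lemma21_holds`) tolerates an extra, not divergence-free, RADIAL drift `β e_r` acting on a radially non-decreasing scalar,
provided `|β| r ≤ A` (Lemma 2.1 away from the axis, uniformly in the scaling) and `|β| √(τ−t) ≤ A` (the tested source term is then
`O(A C_f N^{3/2})` against the axis term `≍ M N²`): a bounded, axisymmetric, smooth ancient solution `f` of
`fₜ + (u + βe_r)·∇f = Δf − (2/r)∂ᵣf`, `r|u| ≤ C_u`, `div u = 0`, vanishing on the axis, satisfies `f ≤ 0`; if moreover `f ≥ 0`
then `f ≡ 0` (`eq_zero_of_nonneg`).  Application (sequel): the disc circulation `Γ = ∫_{D(r,z)} ω₃ ≥ 0` of a closed-hemisphere profile of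
the SPACE–TIME Type-I subclass under the circle-averaged cone — census row «tilt-dominated ⇒ trivial» for crux 25311.

Seat ns-hsw-p1 g3 (LEAD of 25311, cell pub-ns-dss).  WHAT THIS IS NOT: not a statement about Navier–Stokes regularity; a linear
parabolic Liouville tool (KNSS 2009 Thm 5.3 with an extra radial drift); helper `--supports` 25311.
-/

noncomputable section

-- the summit and its single sub-problem share the name (CONVENTIONS §1), as in every Theorems file
set_option linter.dupNamespace false

namespace Summit.NavierStokesRegularity.NavierStokesRegularity.Theorems.HalfSpaceWindowDoorCirculationCarryingRigiditySourcedSwirlLiouville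

open MeasureTheory Set Function Filter Topology TopologicalSpace InnerProductSpace WithLp Metric
open scoped Laplacian RealInnerProductSpace ContDiff
open Literature.Analysis Literature.Analysis.FluidPDE
open Summit.NavierStokesRegularity.NavierStokesRegularity.Theorems.HalfSpaceWindowDoorCirculationCarryingRigidityDefs
open Summit.NavierStokesRegularity.NavierStokesRegularity.Theorems.HalfSpaceWindowDoorCirculationCarryingRigiditySourcedSwirl
open Summit.NavierStokesRegularity.NavierStokesRegularity.Theorems.HalfSpaceWindowDoorCirculationCarryingRigiditySourcedSwirlPlateau
open Summit.NavierStokesRegularity.NavierStokesRegularity.Theorems.HalfSpaceWindowDoorCirculationCarryingRigiditySourcedSwirlSpaceTime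
open Summit.NavierStokesRegularity.NavierStokesRegularity.Theorems.HalfSpaceWindowDoorCirculationCarryingRigiditySourcedSwirlIdentity
open Summit.NavierStokesRegularity.NavierStokesRegularity.Theorems.HalfSpaceWindowDoorCirculationCarryingRigiditySourcedSwirlEstimates
open Summit.NavierStokesRegularity.NavierStokesRegularity.Theorems.HalfSpaceWindowDoorCirculationCarryingRigiditySourcedSwirlSourceEstimate
open Summit.NavierStokesRegularity.NavierStokesRegularity.Theorems.HalfSpaceWindowDoorCirculationCarryingRigiditySourcedSwirl.IsSourcedSwirl
open Summit.NavierStokesRegularity.NavierStokesRegularity.Theorems.HalfSpaceWindowDoorCirculationCarryingRigiditySourcedSwirlPlateau.IsSourcedSwirl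
open Summit.NavierStokesRegularity.NavierStokesRegularity.Theorems.HalfSpaceWindowDoorCirculationCarryingRigiditySourcedSwirlSpaceTime.IsSourcedSwirl
open Summit.NavierStokesRegularity.NavierStokesRegularity.Theorems.HalfSpaceWindowDoorCirculationCarryingRigiditySourcedSwirlIdentity.IsSourcedSwirl
open Summit.NavierStokesRegularity.NavierStokesRegularity.Theorems.HalfSpaceWindowDoorCirculationCarryingRigiditySourcedSwirlEstimates.IsSourcedSwirl
open Summit.NavierStokesRegularity.NavierStokesRegularity.Theorems.HalfSpaceWindowDoorCirculationCarryingRigiditySourcedSwirlSourceEstimate.IsSourcedSwirl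

namespace IsSourcedSwirl

/-! ### The time integral of the source weight -/

/-- `∫₀ᴺ ds/√(τ' − s) ≤ 2√N` for `0 ≤ N < τ'` (antiderivative `−2√(τ' − s)` and `√τ' ≤ √(τ' − N) + √N`). -/
theorem integral_inv_sqrt_le {N τ' : ℝ} (hN : 0 ≤ N) (hτ : N < τ') :
    IntegrableOn (fun s => (Real.sqrt (τ' - s))⁻¹) (Ioc 0 N) ∧
    ∫ s in Ioc 0 N, (Real.sqrt (τ' - s))⁻¹ ≤ 2 * Real.sqrt N := by
  have hcont : ContinuousOn (fun s => (Real.sqrt (τ' - s))⁻¹) (Icc 0 N) := by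
    refine ContinuousOn.inv₀ (by fun_prop) fun s hs => ?_
    exact (Real.sqrt_pos.2 (by linarith [hs.2])).ne'
  have hint : IntegrableOn (fun s => (Real.sqrt (τ' - s))⁻¹) (Ioc 0 N) :=
    (hcont.integrableOn_compact isCompact_Icc).mono_set Ioc_subset_Icc_self
  refine ⟨hint, ?_⟩
  have hderiv : ∀ s ∈ uIcc 0 N, HasDerivAt (fun s => -2 * Real.sqrt (τ' - s)) ((Real.sqrt (τ' - s))⁻¹) s := by
    intro s hs
    rw [uIcc_of_le hN] at hs
    have hpos : 0 < τ' - s := by linarith [hs.2]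
    have h1 : HasDerivAt (fun s => τ' - s) (-1) s := (hasDerivAt_id' s).const_sub τ'
    have h2 := (Real.hasDerivAt_sqrt hpos.ne').comp s h1
    have h3 := h2.const_mul (-2)
    have hne : Real.sqrt (τ' - s) ≠ 0 := (Real.sqrt_pos.2 hpos).ne'
    have e : -2 * (1 / (2 * Real.sqrt (τ' - s)) * -1) = (Real.sqrt (τ' - s))⁻¹ := by
      field_simp
    rw [← e]
    exact h3
  have hcont' : ContinuousOn (fun s => (Real.sqrt (τ' - s))⁻¹) (uIcc 0 N) := by rwa [uIcc_of_le hN]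
  have hFTC := intervalIntegral.integral_eq_sub_of_hasDerivAt hderiv (hcont'.intervalIntegrable)
  rw [← intervalIntegral.integral_of_le hN, hFTC]
  simp only [sub_zero]
  -- `−2√(τ'−N) + 2√τ' ≤ 2√N`
  have hsq : Real.sqrt τ' ≤ Real.sqrt (τ' - N) + Real.sqrt N := by
    have h0 : 0 ≤ Real.sqrt (τ' - N) + Real.sqrt N := by positivity
    have key : τ' ≤ (Real.sqrt (τ' - N) + Real.sqrt N) ^ 2 := by
      nlinarith [Real.sq_sqrt (show 0 ≤ τ' - N by linarith), Real.sq_sqrt hN,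
        Real.sqrt_nonneg (τ' - N), Real.sqrt_nonneg N]
    calc Real.sqrt τ' ≤ Real.sqrt ((Real.sqrt (τ' - N) + Real.sqrt N) ^ 2) := Real.sqrt_le_sqrt key
      _ = Real.sqrt (τ' - N) + Real.sqrt N := Real.sqrt_sq h0
  linarith

/-! ### The sourced swirl Liouville theorem: `f ≤ 0` -/

variable {Cf Cu A : ℝ} {f : ℝ → (EuclideanSpace ℝ (Fin 3)) → ℝ} {u : ℝ → (EuclideanSpace ℝ (Fin 3)) → (EuclideanSpace ℝ (Fin 3))}
  {β : ℝ → (EuclideanSpace ℝ (Fin 3)) → ℝ}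

/-- **The sourced swirl Liouville theorem** (KNSS 2009, proof of Thm 5.3, with an extra radial drift): a sourced swirl triple
on `ℝ³ × (−∞, 0)` — a bounded, axisymmetric, smooth, radially non-decreasing ancient solution `f` of
`fₜ + (u + βe_r)·∇f = Δf − (2/r)∂ᵣf` with `r|u| ≤ C_u`, `div u = 0`, `|β| r ≤ A`, `|β|√(−t) ≤ A`, vanishing on the axis —
satisfies `f ≤ 0`.  Proof: the tree's (`KNSS2009_swirl_sup_nonpos_of_lemma21`): if `M = sup f > 0`, the plateau
(`exists_rescale_ge`) and the tested identity (`spaceTime_identity`) with `L = T = N` give `0 = I₁ + ∫(A₂ + A₃ − A₄)` where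
the axis term is `≤ −c M N²`, the KNSS terms are `O(N) + O(ε N²)` and the NEW source term is `O(A C_f N^{3/2})`
(`estimate_IV`, `integral_inv_sqrt_le`) — impossible for `N` large and `ε` small. -/
theorem nonpos (hP : IsSourcedSwirl Cf Cu A 0 f u β) : ∀ t < 0, ∀ x, f t x ≤ 0 := by
  intro t ht x
  by_contra hxt
  have hpos : 0 < f t x := lt_of_not_ge hxt
  obtain ⟨M, hM, -, hfM, happr⟩ := exists_sup hP ht hpos
  have hCf0 : 0 ≤ Cf := Cf_nonneg hP
  have hCu0 : 0 ≤ Cu := Cu_nonneg hP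
  have hA0 : 0 ≤ A := hP.A_nonneg
  have hC := smoothTransitionC2Bound_nonneg
  have hc₂ := radialConst₂_pos
  have hv₁ : 0 ≤ volume.real (closedBall (0 : EuclideanSpace ℝ (Fin 2)) 1) := measureReal_nonneg
  have hv₂ : 0 ≤ volume.real (closedBall (0 : EuclideanSpace ℝ (Fin 2)) 2) := measureReal_nonneg
  have hv₄ : 0 ≤ volume.real (closedBall (0 : EuclideanSpace ℝ (Fin 2)) 4) := measureReal_nonneg
  -- the `N`-independent constants and the choice of `N = L = T`
  obtain ⟨a₂, ha₂⟩ : ∃ a₂ : ℝ, a₂ = (Cf + M) * (4 * smoothTransitionC2Bound * radialConst₂ *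
      (Cu + (smoothTransitionC2Bound + 1))) := ⟨_, rfl⟩
  obtain ⟨b, hb⟩ : ∃ b : ℝ, b = 32 * smoothTransitionC2Bound * (Cf + M) *
      volume.real (closedBall (0 : EuclideanSpace ℝ (Fin 2)) 1) + 1 := ⟨_, rfl⟩
  obtain ⟨c, hc⟩ : ∃ c : ℝ, c = 64 * A * Cf * smoothTransitionC2Bound *
      volume.real (closedBall (0 : EuclideanSpace ℝ (Fin 2)) 4) := ⟨_, rfl⟩
  have ha₂0 : 0 ≤ a₂ := by rw [ha₂]; positivity
  have hb1 : 1 ≤ b := by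
    have : 0 ≤ 32 * smoothTransitionC2Bound * (Cf + M) *
        volume.real (closedBall (0 : EuclideanSpace ℝ (Fin 2)) 1) := by positivity
    linarith only [this, hb]
  have hc0 : 0 ≤ c := by rw [hc]; positivity
  obtain ⟨m, hm⟩ : ∃ m : ℝ, m = 2 * M * radialConst₂ := ⟨_, rfl⟩
  have hm0 : 0 < m := by rw [hm]; positivity
  obtain ⟨n, hn⟩ := exists_nat_ge (max (max 4 (2 * (a₂ + b) / m + 2)) ((2 * c / m + 1) ^ 2))
  obtain ⟨N, hN⟩ : ∃ N : ℝ, N = n := ⟨_, rfl⟩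
  rw [← hN] at hn
  have hN4 : 4 ≤ N := ((le_max_left _ _).trans (le_max_left _ _)).trans hn
  have hN0 : (0 : ℝ) ≤ N := by linarith only [hN4]
  have hN1 : (1 : ℝ) ≤ N := by linarith only [hN4]
  have hN3 : (3 : ℝ) ≤ N := by linarith only [hN4]
  -- `m (N − 1) ≥ a₂ + b + c √N`
  have hNab : 2 * (a₂ + b) ≤ m * (N - 1) := by
    have h := ((le_max_right _ _).trans (le_max_left _ _)).trans hn
    have h' : 2 * (a₂ + b) / m ≤ N - 2 := by linarith only [h]
    rw [div_le_iff₀ hm0] at h'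
    nlinarith only [h', hm0]
  have hsqN : 2 * c / m + 1 ≤ Real.sqrt N := by
    have h := (le_max_right _ _).trans hn
    have h0 : 0 ≤ 2 * c / m + 1 := by positivity
    calc 2 * c / m + 1 = Real.sqrt ((2 * c / m + 1) ^ 2) := (Real.sqrt_sq h0).symm
      _ ≤ Real.sqrt N := Real.sqrt_le_sqrt h
  have hsqN0 : 0 ≤ Real.sqrt N := Real.sqrt_nonneg N
  have hNc : 2 * (c * Real.sqrt N) ≤ m * (N - 1) := by
    -- `N − 1 = (√N − 1)(√N + 1) ≥ (2c/m)(√N + 1) ≥ (2c/m) √N`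
    have hNsq : Real.sqrt N * Real.sqrt N = N := Real.mul_self_sqrt hN0
    have h1 : 2 * c / m ≤ Real.sqrt N - 1 := by linarith only [hsqN]
    have h2 : 2 * c / m * Real.sqrt N ≤ (Real.sqrt N - 1) * (Real.sqrt N + 1) := by
      have := mul_le_mul_of_nonneg_right h1 (by positivity : (0 : ℝ) ≤ Real.sqrt N + 1)
      have h3 : 2 * c / m * Real.sqrt N ≤ 2 * c / m * (Real.sqrt N + 1) :=
        mul_le_mul_of_nonneg_left (by linarith only [hsqN0]) (by positivity)
      linarith only [this, h3]
    have h4 : (Real.sqrt N - 1) * (Real.sqrt N + 1) = N - 1 := by nlinarith only [hNsq]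
    rw [h4, div_mul_eq_mul_div, div_le_iff₀ hm0] at h2
    linarith only [h2]
  obtain ⟨Bφ, hB⟩ := exists_bound_fderiv_laplacian_phiCut N N
  have hB0 : 0 ≤ Bφ := (norm_nonneg _).trans (hB 0 0).1
  obtain ⟨K₄, hK₄⟩ : ∃ K₄ : ℝ, K₄ = Bφ * (Cu + 1) *
      (2 * N * volume.real (closedBall (0 : EuclideanSpace ℝ (Fin 2)) 2)) := ⟨_, rfl⟩
  have hK₄0 : 0 ≤ K₄ := by rw [hK₄]; positivity
  obtain ⟨D, hD⟩ : ∃ D : ℝ, D = 8 * smoothTransitionC2Bound * N *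
      volume.real (closedBall (0 : EuclideanSpace ℝ (Fin 2)) 2) + N * K₄ := ⟨_, rfl⟩
  have hD0 : 0 ≤ D := by rw [hD]; positivity
  obtain ⟨ε, hε⟩ : ∃ ε : ℝ, ε = min (M / 2) (1 / (2 * (D + 1))) := ⟨_, rfl⟩
  have hε0 : 0 < ε := by rw [hε]; exact lt_min (by positivity) (by positivity)
  have hεM : ε ≤ M / 2 := by rw [hε]; exact min_le_left _ _
  have hεD : ε * D ≤ 1 / 2 := by
    have hεle : ε ≤ 1 / (2 * (D + 1)) := by rw [hε]; exact min_le_right _ _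
    calc ε * D ≤ 1 / (2 * (D + 1)) * D := mul_le_mul_of_nonneg_right hεle hD0
      _ ≤ 1 / 2 := by
          rw [div_mul_eq_mul_div, one_mul, div_le_iff₀ (by positivity)]; linarith only [hD0]
  have hMε : 0 ≤ M - ε := by linarith only [hεM, hM]
  -- the plateau
  obtain ⟨lam, hlam, tstar, htstar, zbar, hge⟩ :=
    exists_rescale_ge hP hM hfM happr (L := N) (T := N) (ε := ε) hN1 hε0
  have hresc := rescale hP hlam tstar zbar N
  set F : ℝ → (EuclideanSpace ℝ (Fin 3)) → ℝ := stPull (lam ^ 2) lam (tstar - lam ^ 2 * N) (zbar • eZ) f with hFdef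
  set V : ℝ → (EuclideanSpace ℝ (Fin 3)) → (EuclideanSpace ℝ (Fin 3)) :=
    lam • stPull (lam ^ 2) lam (tstar - lam ^ 2 * N) (zbar • eZ) u with hVdef
  set Bs : ℝ → (EuclideanSpace ℝ (Fin 3)) → ℝ := lam • stPull (lam ^ 2) lam (tstar - lam ^ 2 * N) (zbar • eZ) β
    with hBsdef
  set τ' : ℝ := N + (0 - tstar) / lam ^ 2 with hτ'def
  have hτ' : N < τ' := by
    have : 0 < (0 - tstar) / lam ^ 2 := div_pos (by linarith only [htstar]) (by positivity)
    rw [hτ'def]; linarith only [this]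
  have hFM : ∀ s < τ', ∀ y, F s y ≤ M := by
    intro s hs y
    rw [hFdef, stPull_rescale_apply]
    apply hfM
    have h1 : s - N < (0 - tstar) / lam ^ 2 := by rw [hτ'def] at hs; linarith only [hs]
    have h2 := (lt_div_iff₀ (by positivity : (0 : ℝ) < lam ^ 2)).1 h1
    linarith only [h2]
  -- the space–time identity and the four estimates, integrated in time
  obtain ⟨hi1, hi2, hi3, hi5, hsum⟩ := spaceTime_identity hresc (L := N) hN0 hτ' M
  obtain ⟨K₁, hK₁⟩ : ∃ K₁ : ℝ, K₁ = 2 * N * ((Cf + M) *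
      volume.real (closedBall (0 : EuclideanSpace ℝ (Fin 2)) 1) +
        ε * volume.real (closedBall (0 : EuclideanSpace ℝ (Fin 2)) 2)) := ⟨_, rfl⟩
  obtain ⟨K₃, hK₃⟩ : ∃ K₃ : ℝ, K₃ = (M - ε) * (4 * radialConst₂ * (N - 1)) := ⟨_, rfl⟩
  obtain ⟨K₅, hK₅⟩ : ∃ K₅ : ℝ, K₅ = Cf * smoothTransitionC2Bound * volume.real (solidCylinder 4 (2 * (N + 1))) :=
    ⟨_, rfl⟩
  have hK₁0 : 0 ≤ K₁ := by rw [hK₁]; positivity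
  have hK₅0 : 0 ≤ K₅ := by rw [hK₅]; exact mul_nonneg (by positivity) measureReal_nonneg
  have hK₅val : K₅ = Cf * smoothTransitionC2Bound * (4 * (N + 1) *
      volume.real (closedBall (0 : EuclideanSpace ℝ (Fin 2)) 4)) := by
    rw [hK₅, volume_real_solidCylinder 4 (by positivity : (0 : ℝ) ≤ 2 * (N + 1))]; ring
  have hA1 : (∫ s in Ioc 0 N, ∫ y, (F s y - M) * (psiCut N y * deriv (zetaCut N) s)) ≤
      ∫ s in Ioc 0 N, |deriv (zetaCut N) s| * K₁ := by
    refine integral_mono_ae hi1 ?_ ?_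
    · exact ((continuous_deriv_zetaCut N).abs.mul continuous_const).integrableOn_Ioc
    · refine (ae_restrict_iff' measurableSet_Ioc).2 (Eventually.of_forall fun s hs => ?_)
      rw [hK₁]
      exact (le_abs_self _).trans (estimate_I hresc hN0 hτ' hε0.le hFM hge hs)
  obtain ⟨hwint, hwle⟩ := integral_inv_sqrt_le hN0 hτ'
  have hA234 : (∫ s in Ioc 0 N, ((∫ y, (F s y - M) *
        (fderiv ℝ (phiCut N N s) y (V s y) + (Δ (phiCut N N s)) y)) +
        (∫ y, 2 / cylRadius y * (F s y * fderiv ℝ (phiCut N N s) y (eR y))) -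
        ∫ y, Bs s y * fderiv ℝ (F s) y (eR y) * phiCut N N s y)) ≤
      ∫ s in Ioc 0 N, ((a₂ - K₃) * zetaCut N s + ε * K₄ + A * K₅ * (Real.sqrt (τ' - s))⁻¹) := by
    refine integral_mono_ae ((hi2.add hi3).sub hi5) ?_ ?_
    · exact ((continuous_const.mul (continuous_zetaCut N)).add continuous_const).integrableOn_Ioc.add
        (hwint.const_mul _)
    · refine (ae_restrict_iff' measurableSet_Ioc).2 (Eventually.of_forall fun s hs => ?_)
      have e2 := estimate_II hresc hN1 hτ' hε0.le hFM hge hB hs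
      have e3 := estimate_III hresc hN1 hτ' hMε hge hs
      have e4 := estimate_IV hresc (L := N) hτ' hs
      rw [← ha₂, ← hK₄] at e2
      rw [← hK₃] at e3
      rw [← hK₅] at e4
      have e2' := le_abs_self (∫ y, (F s y - M) *
        (fderiv ℝ (phiCut N N s) y (V s y) + (Δ (phiCut N N s)) y))
      have e4' := neg_abs_le (∫ y, Bs s y * fderiv ℝ (F s) y (eR y) * phiCut N N s y)
      have e4'' : A / Real.sqrt (τ' - s) * K₅ = A * K₅ * (Real.sqrt (τ' - s))⁻¹ := by ring
      linarith only [e2, e3, e2', e4, e4', e4'']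
  have hIζ' := integral_abs_deriv_zetaCut_le N
  have hIζ := sub_three_le_integral_zetaCut hN3
  have hR1 : (∫ s in Ioc 0 N, |deriv (zetaCut N) s| * K₁) =
      (∫ s in Ioc 0 N, |deriv (zetaCut N) s|) * K₁ := integral_mul_const K₁ _
  have hR2 : (∫ s in Ioc 0 N, ((a₂ - K₃) * zetaCut N s + ε * K₄ + A * K₅ * (Real.sqrt (τ' - s))⁻¹)) =
      (a₂ - K₃) * (∫ s in Ioc 0 N, zetaCut N s) + N * (ε * K₄) +
        A * K₅ * ∫ s in Ioc 0 N, (Real.sqrt (τ' - s))⁻¹ := by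
    rw [integral_add, integral_add, integral_const_mul, integral_Ioc_const hN0, integral_const_mul]
    · exact (continuous_const.mul (continuous_zetaCut N)).integrableOn_Ioc
    · exact continuous_const.integrableOn_Ioc
    · exact (continuous_const.mul (continuous_zetaCut N)).integrableOn_Ioc.add continuous_const.integrableOn_Ioc
    · exact hwint.const_mul _
  -- the source contribution: `A K₅ ∫ (τ'−s)^{-1/2} ≤ A K₅ 2√N = (c/8) (N+1) √N ≤ (c/4) N √N`
  have hE : A * K₅ * ∫ s in Ioc 0 N, (Real.sqrt (τ' - s))⁻¹ ≤ c * √N / 4 * N := by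
    have h1 : A * K₅ * ∫ s in Ioc 0 N, (Real.sqrt (τ' - s))⁻¹ ≤ A * K₅ * (2 * Real.sqrt N) :=
      mul_le_mul_of_nonneg_left hwle (by positivity)
    have h2 : A * K₅ * (2 * Real.sqrt N) = c / 8 * (N + 1) * Real.sqrt N := by
      rw [hK₅val, hc]; ring
    have h3 : c / 8 * (N + 1) * Real.sqrt N ≤ c * Real.sqrt N / 4 * N := by
      have : (N + 1) ≤ 2 * N := by linarith only [hN1]
      nlinarith only [this, hc0, hsqN0, mul_nonneg hc0 hsqN0]
    linarith only [h1, h2, h3]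
  -- the sign of `a₂ − K₃` and the elementary inequalities
  have hK₃ge : a₂ + b + c * Real.sqrt N ≤ K₃ := by
    have h1 : m * (N - 1) ≤ K₃ := by
      rw [hK₃, hm]
      nlinarith only [mul_nonneg (mul_nonneg hc₂.le (show (0 : ℝ) ≤ N - 1 by linarith only [hN4]))
        (show (0 : ℝ) ≤ M - 2 * ε by linarith only [hεM])]
    linarith only [h1, hNab, hNc]
  have hfin1 : (∫ s in Ioc 0 N, |deriv (zetaCut N) s|) * K₁ ≤ 4 * smoothTransitionC2Bound * K₁ :=
    mul_le_mul_of_nonneg_right hIζ' hK₁0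
  have hCK₁ : smoothTransitionC2Bound * K₁ = smoothTransitionC2Bound * (2 * N * ((Cf + M) *
      volume.real (closedBall (0 : EuclideanSpace ℝ (Fin 2)) 1) +
        ε * volume.real (closedBall (0 : EuclideanSpace ℝ (Fin 2)) 2))) := by rw [hK₁]
  have hfin2 : (a₂ - K₃) * (∫ s in Ioc 0 N, zetaCut N s) ≤ (a₂ - K₃) * (N - 3) :=
    mul_le_mul_of_nonpos_left hIζ (by linarith only [hK₃ge, hb1, mul_nonneg hc0 hsqN0])
  have hfin3 : (a₂ - K₃) * (N - 3) ≤ -(b + c * Real.sqrt N) * (N - 3) :=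
    mul_le_mul_of_nonneg_right (by linarith only [hK₃ge]) (by linarith only [hN4])
  have hbN : b * (N - 3) = (32 * smoothTransitionC2Bound * (Cf + M) *
      volume.real (closedBall (0 : EuclideanSpace ℝ (Fin 2)) 1) + 1) * (N - 3) := by rw [hb]
  have hfin4 : 8 * smoothTransitionC2Bound * (Cf + M) *
      volume.real (closedBall (0 : EuclideanSpace ℝ (Fin 2)) 1) * N ≤
      32 * smoothTransitionC2Bound * (Cf + M) *
        volume.real (closedBall (0 : EuclideanSpace ℝ (Fin 2)) 1) * (N - 3) := by
    have hP0 : 0 ≤ smoothTransitionC2Bound * (Cf + M) *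
        volume.real (closedBall (0 : EuclideanSpace ℝ (Fin 2)) 1) := by positivity
    linarith only [mul_nonneg hP0 (show (0 : ℝ) ≤ 24 * N - 96 by linarith only [hN4])]
  -- the source term is absorbed by `c √N (N − 3) ≥ (c √N / 4) N` (`N ≥ 4`)
  have hfin5 : c * Real.sqrt N / 4 * N ≤ c * Real.sqrt N * (N - 3) := by
    have h0 : 0 ≤ c * Real.sqrt N := mul_nonneg hc0 hsqN0
    nlinarith only [h0, hN4]
  -- `0 = ∫A₁ + ∫(A₂ + A₃ − A₄) ≤ ε D − 1 ≤ −1/2`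
  have key : (0 : ℝ) ≤ 8 * smoothTransitionC2Bound * N * ε *
      volume.real (closedBall (0 : EuclideanSpace ℝ (Fin 2)) 2) + N * (ε * K₄) - 1 := by
    nlinarith only [hsum, hA1, hR1, hfin1, hCK₁, hA234, hR2, hE, hfin2, hfin3, hbN, hfin4, hfin5, hN4, hC,
      hCf0, hM.le, hv₁]
  have hεD' : ε * D = 8 * smoothTransitionC2Bound * N * ε *
      volume.real (closedBall (0 : EuclideanSpace ℝ (Fin 2)) 2) + N * (ε * K₄) := by
    rw [hD]; ring
  linarith only [hεD, hεD', key]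

/-- For a sourced swirl triple with a NON-NEGATIVE scalar (as for the disc circulation of a closed-hemisphere profile) the
scalar vanishes identically. -/
theorem eq_zero_of_nonneg (hP : IsSourcedSwirl Cf Cu A 0 f u β) (hnn : ∀ t < 0, ∀ x, 0 ≤ f t x) :
    ∀ t < 0, ∀ x, f t x = 0 :=
  fun t ht x => le_antisymm (nonpos hP t ht x) (hnn t ht x)

end IsSourcedSwirl

end Summit.NavierStokesRegularity.NavierStokesRegularity.Theorems.HalfSpaceWindowDoorCirculationCarryingRigiditySourcedSwirlLiouville

end
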